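import Summits.QuantumAdvantage.QuantumAdvantage.Theorems.LinnikCubicClassGroupsDegreeOnePrimesEscapeShortIntervalWindowExc
import Summits.QuantumAdvantage.QuantumAdvantage.Theorems.LinnikCubicClassGroupsDegreeOnePrimesEscapeShortIntervalZeroSumZFR
import Summits.QuantumAdvantage.QuantumAdvantage.Theorems.LinnikCubicClassGroupsDegreeOnePrimesEscapeFrobeniusWindowBookkeeping
import HarnessLib

/-!
# Prime ideals of a class in short intervals with Deuring–Heilbronn, I: the core window estimate

Topic `Summits/QuantumAdvantage/QuantumAdvantage/Theorems`, cell B2b-1 (linnik-cubic), PART A (gen 19);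
helper toward the crux `DegreeOnePrimesEscape` (stmt-QuantumAdvantage-11543) of route
`LinnikCubicClassGroups` — the DEURING–HEILBRONN-SHARP HOHEISEL–LINNIK THEOREM FOR IDEAL CLASSES
(two-sided class prime number theorem in short intervals for every ideal class of every number field).
HONEST FRAMING: the value of this file is a THEOREM (kernel-checked lemma) — NOT summit progress.

`classWindow_core_dh` is `window_error_le_exc` (gen 5, collar `η/4`, classical zero-free region,
fixed precision `xη/8`) with three generalisations needed for a two-sided estimate of prescribed
relative precision with the Deuring–Heilbronn phenomenon:
* a general collar `ε = ε₀η`, `0 < ε₀ ≤ 1/4` (the real bookkeeping `frobWindow_bookkeeping`, gen 17);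
* the zero-free region off the exceptional segment `excRegion c K` up to height `T₁ = X^θ` is a
  HYPOTHESIS with its own constant `c_Z` (`fam_zeroSum_window_le_of_zfr`, gen 17);
* the secondary terms are bounded by a parameter `κ₂` (hypothesis `hjunk`).
Conclusion: for every class `C` and admissible exceptional sets `Exc ψ`,
`‖h_K ψ̃_C(g) − F(−1) + Σ_ψ ψ(C⁻¹) Σ_{ρ∈Exc ψ} m_ψ(ρ) F(−ρ)‖ ≤ ((9/2)·2eD e^{−c_Z/(6θ)} + κ₂)·x·η`
for the window weight `g = windowTest lo hi (ε₀η)`, `log x ≤ lo < hi ≤ log x + η`.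

References: G. Hoheisel, S.-B. Preuss. Akad. Wiss. (1930) 580–588; [LagariasMontgomeryOdlyzko1979, §7];
[ThornerZaman2019, Thm. 3.1, §5].
-/

noncomputable section

open Complex Real MeasureTheory Set Filter Topology
open scoped NumberField nonZeroDivisors

namespace Summit.QuantumAdvantage.QuantumAdvantage.Theorems.DegreeOnePrimesEscape

open Literature.NumberTheory.LFunctions Literature.NumberTheory.LFunctions.NumberField
  Literature.NumberTheory.LFunctions.EntireEF Literature.NumberTheory.LFunctions.WindowWeight
  Literature.NumberTheory.LFunctions.AbelianDensity

variable {K : Type} [Field K] [NumberField K]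

set_option maxHeartbeats 1600000 in
/-- **The core window estimate for the smoothed class sum, with a prescribed zero-free region and a
general collar.**  Let `K` have degree `n > 1`, let the log-free density bound in `Q`-form hold with
constants `b, D, a`, let `c_Z > 0` be a zero-free constant for the zeros of the family of height
`≤ T₁ = e^{θ(hi+ε)}` off the exceptional segment `excRegion c K`; let `0 < θ ≤ 1/8`, `θ b ≤ 1/8`,
`x > 1`, `a log Q ≤ θ log x`, `2 ≤ θ log x`, `0 < η ≤ log 2`, `x^{−θ/8} ≤ 2η`, collar `ε = ε₀η` with
`0 < ε₀ ≤ 1/4`, and the secondary terms bounded by `κ₂` (`hjunk`).  Then for every window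
`log x ≤ lo < hi ≤ log x + η`, every class `C` and admissible exceptional sets `Exc ψ` (finite sets of
non-trivial zeros of `F_ψ` containing those on the exceptional segment):
`‖h_K ψ̃_C(g) − F(−1) + Σ_ψ ψ(C⁻¹) Σ_{ρ ∈ Exc ψ} m_ψ(ρ) F(−ρ)‖ ≤ ((9/2)·2eD e^{−c_Z/(6θ)} + κ₂) x η`. -/
theorem classWindow_core_dh {n : ℕ} (hn : 1 < n) (hKn : Module.finrank ℚ K = n)
    {b D a : ℝ} (hb : 0 < b) (hD : 0 < D) (ha : 1 ≤ a)
    (hdens : ∀ (T : ℝ), 1 ≤ T → ∀ u : AddChar (Additive (ClassGroup (𝓞 K))) ℂ → Finset ℂ,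
        (∀ ψ, ∀ ρ ∈ u ψ, famF K ψ ρ = 0 ∧ 1 / 4 ≤ ρ.re ∧ ρ.re < 1 ∧ |ρ.im| ≤ T) →
        ∀ α : ℝ, α ≤ 1 →
          ∑ ψ, ∑ ρ ∈ u ψ with α ≤ ρ.re, (famMult K ψ ρ : ℝ) ≤
            D * Real.exp (b * (a * Real.log (ThornerZaman.condQn K) + Real.log (T + 4))) ^ (1 - α))
    (c : ℝ) {cZ : ℝ} (hcZ : 0 < cZ)
    {M : ℝ} (hM1 : 1 ≤ M)
    (hM : ∀ y : ℝ, |iteratedDeriv 1 Real.smoothTransition y| ≤ M ∧ |iteratedDeriv 2 Real.smoothTransition y| ≤ M)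
    {A_L : ℝ} (hAL : 0 < A_L)
    (hA : ∀ (K' : Type) [Field K'] [NumberField K'] (χ : ClassGroup (𝓞 K') →* ℂˣ) (t : ℝ),
      ‖logDeriv (classGroupLFunction K' χ) (-1 / 2 + t * I)‖ ≤
        A_L * (Module.finrank ℚ K' + 1) * (Real.log ((NumberField.discr K').natAbs : ℝ) + Real.log (|t| + 4)))
    {θ : ℝ} (hθ0 : 0 < θ) (hθb : θ * b ≤ 1 / 8) (hθ1 : θ ≤ 1 / 8)
    {x η : ℝ} (hx1 : 1 < x)
    (haθ : a * Real.log (ThornerZaman.condQn K) ≤ θ * Real.log x) (h2θ : 2 ≤ θ * Real.log x)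
    (hη0 : 0 < η) (hη1 : η ≤ Real.log 2) (hηx : Real.exp (-(θ / 8) * Real.log x) ≤ 2 * η)
    {lo hi : ℝ} (hlo : Real.log x ≤ lo) (hlohi : lo < hi) (hhi : hi ≤ Real.log x + η)
    {ε₀ : ℝ} (hε₀0 : 0 < ε₀) (hε₀1 : ε₀ ≤ 1 / 4) {κ₂ : ℝ}
    (hjunk : (338 * (512 * ((n : ℝ) + 1)) + 96 * (M / (4 * ε₀)) * (512 * ((n : ℝ) + 1)) *
        (4 * tailConst₁ + tailConst₂) + 108 + 640 * leftLineConst * A_L * (M / (4 * ε₀))) *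
        ThornerZaman.condQn K ^ (7 : ℕ) * (Real.log x + 1) * Real.exp (-(θ / 4) * Real.log x) ≤ κ₂)
    (hzfr : ∀ (ψ : AddChar (Additive (ClassGroup (𝓞 K))) ℂ) (ρ : ℂ), famF K ψ ρ = 0 → 1 / 4 ≤ ρ.re →
        ρ.re < 1 → |ρ.im| ≤ Real.exp (θ * (hi + ε₀ * η)) → ¬ excRegion c K ρ →
          ρ.re ≤ 1 - cZ / (a * Real.log (ThornerZaman.condQn K) + Real.log (|ρ.im| + 4)))
    (C : ClassGroup (𝓞 K)) (Exc : AddChar (Additive (ClassGroup (𝓞 K))) ℂ → Finset ℂ)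
    (hExc : ∀ ψ, ∀ ρ ∈ Exc ψ, famF K ψ ρ = 0 ∧ 0 < ρ.re ∧ ρ.re < 1)
    (hExc' : ∀ ψ ρ, famF K ψ ρ = 0 → 0 < ρ.re → ρ.re < 1 → excRegion c K ρ → ρ ∈ Exc ψ) :
    ‖(NumberField.classNumber K : ℂ) * (smoothedPsiClass K C (windowTest lo hi (ε₀ * η)) : ℂ) -
        fordLaplace (windowTest lo hi (ε₀ * η)) (-1) +
        ∑ ψ : AddChar (Additive (ClassGroup (𝓞 K))) ℂ, ψ (Additive.ofMul C⁻¹) *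
          ∑ ρ ∈ Exc ψ, (famMult K ψ ρ : ℂ) * fordLaplace (windowTest lo hi (ε₀ * η)) (-ρ)‖ ≤
      (9 / 2 * (2 * Real.exp 1 * D * Real.exp (-(cZ / (6 * θ)))) + κ₂) * x * η := by
  classical
  obtain ⟨hc₁16, hc₂0⟩ := tailConst_nonneg
  have hlC := leftLineConst_nonneg
  have hK : 1 < Module.finrank ℚ K := by rw [hKn]; exact hn
  have hQ12 : (12 : ℝ) ≤ ThornerZaman.condQn K := ThornerZaman.twelve_le_condQn (K := K) hK
  have hx0 : 0 < x := by linarith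
  have hL0 : 0 < Real.log x := Real.log_pos hx1
  have hxexp : Real.exp (Real.log x) = x := Real.exp_log hx0
  -- `L ≥ 16`, hence `ε = ε₀ η ≤ η/4 < lo`
  have hlog2 : Real.log 2 < 0.6931471808 := Real.log_two_lt_d9
  have hθL8 : θ * Real.log x ≤ Real.log x / 8 := by
    have := mul_le_mul_of_nonneg_right hθ1 hL0.le; linarith
  set ε : ℝ := ε₀ * η with hε
  have hε0 : 0 < ε := by positivity
  have hε4 : ε ≤ η / 4 := by
    rw [hε]; have := mul_le_mul_of_nonneg_right hε₀1 hη0.le; linarith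
  have hεlo : ε < lo := by linarith
  set ℓ : ℝ := hi - lo + 2 * ε with hℓ
  have hℓ0 : 0 < ℓ := by rw [hℓ]; linarith
  have hLX0 : 0 ≤ hi + ε := by linarith
  have hT₁1 : 1 ≤ Real.exp (θ * (hi + ε)) := Real.one_le_exp (mul_nonneg hθ0.le hLX0)
  -- the range condition
  have hrange : Real.exp (b * (a * Real.log (ThornerZaman.condQn K) + Real.log (Real.exp (θ * (hi + ε)) + 4))) ≤
      Real.exp (hi + ε) ^ ((1 : ℝ) / 2) :=
    frobWindow_range (LX := hi + ε) hb hθ0 hθb hθ1 haθ h2θ hlo hlohi hε0 rfl rfl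
  -- sizes of the field data
  have hnQ : (Module.finrank ℚ K : ℝ) ≤ ThornerZaman.condQn K := ThornerZaman.finrank_le_condQn (K := K)
  have hhK : (NumberField.classNumber K : ℝ) ≤ ThornerZaman.condQn K ^ (4 : ℕ) :=
    ThornerZaman.classNumber_le_condQn_pow (K := K) hK
  have hAK4 : Real.log ((NumberField.discr K).natAbs : ℝ) + 3 * Module.finrank ℚ K ≤
      4 * ThornerZaman.condQn K := windowConst_le_condQn K
  have hlogd0 : 0 ≤ Real.log ((NumberField.discr K).natAbs : ℝ) := Real.log_natCast_nonneg _
  -- the two-sided smoothed estimate with the exceptional zeros `Exc` and the ZFR constant `c_Z`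
  have hsm := norm_classNumber_mul_smoothedPsiClass_window_sub_le (K := K) (c := c) hε0 hεlo hlohi C
    Exc hExc hExc'
    (fun u hu ↦ fam_zeroSum_window_le_of_zfr hb hD ha hK hdens c hcZ hM hε0 hεlo hlohi hT₁1 hzfr hrange u hu)
    (M₀ := 64 * ThornerZaman.condQn K * ℓ)
    (fun ψ ↦ ?_)
    (norm_dzEFRemainder_windowTest_zero_le hAL hA hM hε0 hεlo hlohi)
    (fun ψ hψ ↦ norm_cgEFRemainder_windowTest_zero_le hAL hA (toHomUnits_ne_one hψ) hM hε0 hεlo hlohi)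
  swap
  · -- the trivial-zero multiplicities: `m_ψ(0) ≤ 8(log|d_K| + 6n + 3) ≤ 64 Q`
    have hm : (famMult K ψ 0 : ℝ) ≤ 64 * ThornerZaman.condQn K := by
      by_cases hψ : ψ = 0
      · subst hψ
        rw [famMult, famF_zero]
        refine (analyticOrderNatAt_dedekindZeta₁_zero_le (K := K)).trans ?_
        linarith
      · rw [famMult, famF_of_ne hψ]
        refine (analyticOrderNatAt_classGroupLFunction₀_zero_le (toHomUnits_ne_one hψ)).trans ?_
        linarith
    have := mul_le_mul_of_nonneg_right hm hℓ0.le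
    linarith
  refine hsm.trans ?_
  have hbook := frobWindow_bookkeeping (W₀ := 512 * ((Module.finrank ℚ K : ℝ) + 1)) (A_L := A_L)
    (AK := Real.log ((NumberField.discr K).natAbs : ℝ) + 3 * Module.finrank ℚ K)
    (hK := (NumberField.classNumber K : ℝ)) (κ₁ := 2 * Real.exp 1 * D * Real.exp (-(cZ / (6 * θ))))
    (κ₂ := κ₂) (L := Real.log x) (ℓ := hi - lo + 2 * ε) (LX := hi + ε) (X := Real.exp (hi + ε))
    (T₁ := Real.exp (θ * (hi + ε)))
    hQ12 hM1 hAL (by positivity) hlC hc₁16 hc₂0 hD hcZ ha hhK (Nat.cast_nonneg _) rfl hAK4 hlogd0 hnQ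
    (Nat.cast_nonneg _) hθ0 hθ1 le_rfl haθ h2θ hη0 hη1 hηx hε₀0 hε₀1 (by rw [hKn]; exact hjunk)
    hlo hlohi hhi hε rfl rfl rfl rfl
  rw [hxexp] at hbook
  refine hbook.trans (le_of_eq ?_)
  ring

end Summit.QuantumAdvantage.QuantumAdvantage.Theorems.DegreeOnePrimesEscape

end
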